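import Mathlib
import Summits.Ventures.FusionMHD.Models.TearingFRS1Matching
import HarnessLib

/-!
# F3.r3 instance «TearingFRS1»: the analytic tools of the RIGHT outer solve — linearity, a leftward Grönwall step
# with the model's explicit Lipschitz constant, the global wall solution, and an elementary exponential bound

Companion of `TearingFRS1Matching.lean` (model-6; `models/F3-SCOPING.md` §7b). The right outer solution `R` of MODEL M
(wall at `u_b = 6`: `R(6) = 0`, `R′(6) = −1`) is continued from the wall to the matching point `u = 5/4` through a
chain of regular points; at each point ONE exact power series through a rounded centre is certified, and the
rounding + truncation error is carried by Grönwall's inequality. This file provides the analysis, once: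

* `IsScaledOuterSolution.sub` — differences of outer solutions are outer solutions (linearity);
* `modelCoeff_le` — on `[u₁, u₀] ⊂ (1, ∞)` the coefficients obey `1/u + |4/u² + 560/((7+3u²)²(u²−1))| ≤ 1/u₁ + c(u₁)`
  (every term is positive and decreasing in `u > 1`);
* **`outer_gronwall_left`** — if `(Z, Z′)` is an outer solution on `[u₁, u₀]` (`u₁ > 1`) and `K ≥ 1` bounds
  `1/u + |c(u)|` there, then `max |Z u₁| |Z′ u₁| ≤ max |Z u₀| |Z′ u₀| · exp (K (u₀ − u₁))`
  (Mathlib's `norm_le_gronwallBound_of_norm_deriv_right_le`, run backwards in `u`, sup norm on `ℝ × ℝ`)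
  [Hartman, ODE, Ch. IV Lemma 1.1 — cite key `Hartman2002`];
* `wallSolution_exists` — a GLOBAL outer solution on `(1, ∞)` with `R(6) = 0`, `R′(6) = −1`
  (`Literature.Analysis.ODE.exists_solution_Ioi`: `p = −1/u`, `q = c(u)` are continuous on `(1, ∞)`), and
  `outer_eqOn` — uniqueness on subintervals (`eqOn_of_solution_Ioo`), so each certified series IS that solution;
* `exp_le_inv_pow` — `exp x ≤ ((1 − x/n)⁻¹)ⁿ` for `0 ≤ x < n` (rational upper bounds for the Grönwall factors).
[instance data / folklore]
-/

noncomputable section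

open Set Filter Real Literature.Analysis.ODE
open scoped Topology

namespace Summit.Ventures.FusionMHD.Models

namespace TearingFRS1

/-- The model coefficient `c(u) = 4/u² + 560/((7+3u²)²(u²−1))` of `ψ″ = −ψ′/u + c(u) ψ` (in `u = r/r_s`). [instance data] -/
def modelC (u : ℝ) : ℝ := 4 / u ^ 2 + 560 / ((7 + 3 * u ^ 2) ^ 2 * (u ^ 2 - 1))

/-- Unfolding `IsScaledOuterSolution` with `modelC`. [instance data] -/
theorem isScaledOuterSolution_iff (L L' : ℝ → ℝ) (s : Set ℝ) :
    IsScaledOuterSolution L L' s ↔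
      ∀ u ∈ s, HasDerivAt L (L' u) u ∧ HasDerivAt L' (-(L' u) / u + modelC u * L u) u := Iff.rfl

/-- Differences of outer solutions are outer solutions. [instance data] -/
theorem IsScaledOuterSolution.sub {L L' R R' : ℝ → ℝ} {s : Set ℝ} (hL : IsScaledOuterSolution L L' s)
    (hR : IsScaledOuterSolution R R' s) :
    IsScaledOuterSolution (fun u => L u - R u) (fun u => L' u - R' u) s := by
  intro u hu
  obtain ⟨h1, h2⟩ := hL u hu
  obtain ⟨h3, h4⟩ := hR u hu
  refine ⟨h1.sub h3, (h2.sub h4).congr_deriv ?_⟩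
  ring

/-- Restriction of outer solutions to subsets. [instance data] -/
theorem IsScaledOuterSolution.mono {L L' : ℝ → ℝ} {s t : Set ℝ} (hL : IsScaledOuterSolution L L' s) (hts : t ⊆ s) :
    IsScaledOuterSolution L L' t := fun u hu => hL u (hts hu)

/-- `c(u) > 0` for `u > 1`. [instance data] -/
theorem modelC_pos {u : ℝ} (hu : 1 < u) : 0 < modelC u := by
  have h1 : 0 < u ^ 2 - 1 := by nlinarith
  unfold modelC
  positivity

/-- Monotonicity: for `1 < u₁ ≤ u`, `c(u) ≤ c(u₁)`. [instance data] -/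
theorem modelC_le {u₁ u : ℝ} (h1 : 1 < u₁) (hu : u₁ ≤ u) : modelC u ≤ modelC u₁ := by
  have hu0 : 0 < u₁ := by linarith
  have hA : 4 / u ^ 2 ≤ 4 / u₁ ^ 2 := by
    apply div_le_div_of_nonneg_left (by norm_num) (by positivity)
    exact pow_le_pow_left₀ hu0.le hu 2
  have hB : 560 / ((7 + 3 * u ^ 2) ^ 2 * (u ^ 2 - 1)) ≤ 560 / ((7 + 3 * u₁ ^ 2) ^ 2 * (u₁ ^ 2 - 1)) := by
    have h1' : 0 < u₁ ^ 2 - 1 := by nlinarith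
    apply div_le_div_of_nonneg_left (by norm_num) (by positivity)
    have hsq : u₁ ^ 2 ≤ u ^ 2 := pow_le_pow_left₀ hu0.le hu 2
    have h7 : (7 + 3 * u₁ ^ 2) ^ 2 ≤ (7 + 3 * u ^ 2) ^ 2 := pow_le_pow_left₀ (by positivity) (by linarith) 2
    exact mul_le_mul h7 (by linarith) h1'.le (by positivity)
  unfold modelC
  linarith

/-- THE LIPSCHITZ CONSTANT on a segment: for `u ∈ [u₁, u₀]`, `u₁ > 1`: `1/u + |c(u)| ≤ 1/u₁ + c(u₁)`. [instance data] -/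
theorem modelCoeff_le {u₁ u : ℝ} (h1 : 1 < u₁) (hu : u₁ ≤ u) : 1 / u + |modelC u| ≤ 1 / u₁ + modelC u₁ := by
  have hc := modelC_le h1 hu
  have hpos := modelC_pos (lt_of_lt_of_le h1 hu)
  rw [abs_of_pos hpos]
  have : 1 / u ≤ 1 / u₁ := one_div_le_one_div_of_le (by linarith) hu
  linarith

/-- **GRÖNWALL STEP, LEFTWARD.** Let `(Z, Z′)` be an outer solution of MODEL M at every point of `[u₁, u₀]`, `u₁ > 1`,
and let `K ≥ 1` bound `1/u + |c(u)|` on the segment. Then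
`max |Z u₁| |Z′ u₁| ≤ max |Z u₀| |Z′ u₀| · exp (K (u₀ − u₁))`. [cite: Hartman2002, Ch. IV Lemma 1.1 (Grönwall)] -/
theorem outer_gronwall_left {Z Z' : ℝ → ℝ} {u₁ u₀ K : ℝ} (h1 : 1 < u₁) (h10 : u₁ ≤ u₀)
    (hZ : IsScaledOuterSolution Z Z' (Icc u₁ u₀)) (hK : ∀ u ∈ Icc u₁ u₀, 1 / u + |modelC u| ≤ K) (hK1 : 1 ≤ K) :
    max |Z u₁| |Z' u₁| ≤ max |Z u₀| |Z' u₀| * Real.exp (K * (u₀ - u₁)) := by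
  -- run the solution backwards: `F s = (Z (u₀ - s), Z' (u₀ - s))`, `s ∈ [0, u₀ - u₁]`
  set F : ℝ → ℝ × ℝ := fun s => (Z (u₀ - s), Z' (u₀ - s)) with hF
  set F' : ℝ → ℝ × ℝ := fun s =>
    (-(Z' (u₀ - s)), -(-(Z' (u₀ - s)) / (u₀ - s) + modelC (u₀ - s) * Z (u₀ - s))) with hF'
  have hderiv : ∀ s ∈ Icc 0 (u₀ - u₁), HasDerivAt F (F' s) s := by
    intro s hs
    have hus : u₀ - s ∈ Icc u₁ u₀ := ⟨by linarith [hs.2], by linarith [hs.1]⟩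
    obtain ⟨hz, hz'⟩ := (isScaledOuterSolution_iff Z Z' _).1 hZ (u₀ - s) hus
    have hlin : HasDerivAt (fun s : ℝ => u₀ - s) (-1) s := by
      simpa using (hasDerivAt_id s).const_sub u₀
    have h1 := hz.comp s hlin
    have h2 := hz'.comp s hlin
    have e1 : HasDerivAt (fun s => Z (u₀ - s)) (-(Z' (u₀ - s))) s := h1.congr_deriv (by ring)
    have e2 : HasDerivAt (fun s => Z' (u₀ - s)) (-(-(Z' (u₀ - s)) / (u₀ - s) + modelC (u₀ - s) * Z (u₀ - s))) s :=
      h2.congr_deriv (by rw [modelC]; ring)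
    exact e1.prodMk e2
  have hcont : ContinuousOn F (Icc 0 (u₀ - u₁)) := fun s hs => (hderiv s hs).continuousAt.continuousWithinAt
  have hbound : ∀ s ∈ Ico 0 (u₀ - u₁), ‖F' s‖ ≤ K * ‖F s‖ + 0 := by
    intro s hs
    have hus : u₀ - s ∈ Icc u₁ u₀ := ⟨by linarith [hs.2], by linarith [hs.1]⟩
    have hKs := hK (u₀ - s) hus
    have hu1 : 1 < u₀ - s := lt_of_lt_of_le h1 hus.1
    rw [add_zero, hF', Prod.norm_mk, Real.norm_eq_abs, Real.norm_eq_abs]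
    have hn1 : |Z (u₀ - s)| ≤ ‖F s‖ := by rw [hF, Prod.norm_mk, Real.norm_eq_abs]; exact le_max_left _ _
    have hn2 : |Z' (u₀ - s)| ≤ ‖F s‖ := by
      rw [hF, Prod.norm_mk, Real.norm_eq_abs, Real.norm_eq_abs]; exact le_max_right _ _
    have hF0 : 0 ≤ ‖F s‖ := norm_nonneg _
    refine max_le ?_ ?_
    · rw [abs_neg]
      calc |Z' (u₀ - s)| ≤ ‖F s‖ := hn2
        _ ≤ K * ‖F s‖ := le_mul_of_one_le_left hF0 hK1
    · rw [abs_neg]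
      have hu0 : 0 < u₀ - s := by linarith
      calc |-(Z' (u₀ - s)) / (u₀ - s) + modelC (u₀ - s) * Z (u₀ - s)|
          ≤ |-(Z' (u₀ - s)) / (u₀ - s)| + |modelC (u₀ - s) * Z (u₀ - s)| := abs_add_le _ _
        _ = 1 / (u₀ - s) * |Z' (u₀ - s)| + |modelC (u₀ - s)| * |Z (u₀ - s)| := by
            rw [abs_div, abs_neg, abs_of_pos hu0, abs_mul]; ring
        _ ≤ 1 / (u₀ - s) * ‖F s‖ + |modelC (u₀ - s)| * ‖F s‖ :=
            add_le_add (mul_le_mul_of_nonneg_left hn2 (by positivity))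
              (mul_le_mul_of_nonneg_left hn1 (abs_nonneg _))
        _ = (1 / (u₀ - s) + |modelC (u₀ - s)|) * ‖F s‖ := by ring
        _ ≤ K * ‖F s‖ := mul_le_mul_of_nonneg_right hKs hF0
  have h0 : ‖F 0‖ ≤ max |Z u₀| |Z' u₀| := by
    rw [hF, Prod.norm_mk, Real.norm_eq_abs, Real.norm_eq_abs, sub_zero]
  have key := norm_le_gronwallBound_of_norm_deriv_right_le hcont
    (fun s hs => (hderiv s (Ico_subset_Icc_self hs)).hasDerivWithinAt) h0 hbound (u₀ - u₁)
    ⟨by linarith, le_rfl⟩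
  rw [gronwallBound_ε0, sub_zero] at key
  have e : ‖F (u₀ - u₁)‖ = max |Z u₁| |Z' u₁| := by
    rw [hF, Prod.norm_mk, Real.norm_eq_abs, Real.norm_eq_abs, sub_sub_cancel]
  rwa [e] at key

/-- One propagation step in the form the chain uses: from `|Z u₀|, |Z′ u₀| ≤ w` to
`|Z u₁|, |Z′ u₁| ≤ w · E` for any `E ≥ exp (K (u₀ − u₁))`. [instance data] -/
theorem outer_step {Z Z' : ℝ → ℝ} {u₁ u₀ K w E : ℝ} (h1 : 1 < u₁) (h10 : u₁ ≤ u₀)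
    (hZ : IsScaledOuterSolution Z Z' (Icc u₁ u₀)) (hK : ∀ u ∈ Icc u₁ u₀, 1 / u + |modelC u| ≤ K) (hK1 : 1 ≤ K)
    (hw : |Z u₀| ≤ w ∧ |Z' u₀| ≤ w) (hE : Real.exp (K * (u₀ - u₁)) ≤ E) :
    |Z u₁| ≤ w * E ∧ |Z' u₁| ≤ w * E := by
  have h := outer_gronwall_left h1 h10 hZ hK hK1
  have hw' : max |Z u₀| |Z' u₀| ≤ w := max_le hw.1 hw.2
  have hw0 : 0 ≤ w := (abs_nonneg _).trans hw.1
  have hexp : 0 ≤ Real.exp (K * (u₀ - u₁)) := (Real.exp_pos _).le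
  have h' : max |Z u₁| |Z' u₁| ≤ w * E :=
    h.trans ((mul_le_mul_of_nonneg_right hw' hexp).trans (mul_le_mul_of_nonneg_left hE hw0))
  exact ⟨(le_max_left _ _).trans h', (le_max_right _ _).trans h'⟩

/-- The constant of a segment: `K = max 1 (1/u₁ + c(u₁))` works on `[u₁, u₀]`. [instance data] -/
theorem segment_K {u₁ u₀ : ℝ} (h1 : 1 < u₁) :
    (∀ u ∈ Icc u₁ u₀, 1 / u + |modelC u| ≤ max 1 (1 / u₁ + modelC u₁)) ∧ 1 ≤ max 1 (1 / u₁ + modelC u₁) :=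
  ⟨fun _ hu => (modelCoeff_le h1 hu.1).trans (le_max_right _ _), le_max_left _ _⟩

/-! ### The global wall solution and uniqueness -/

/-- `c` is continuous on `(1, ∞)`. [instance data] -/
theorem continuousOn_modelC : ContinuousOn modelC (Ioi 1) := by
  have h : ∀ u ∈ Ioi (1 : ℝ), (7 + 3 * u ^ 2) ^ 2 * (u ^ 2 - 1) ≠ 0 := by
    intro u hu
    have hu : (1 : ℝ) < u := hu
    have : 0 < u ^ 2 - 1 := by nlinarith
    positivity
  unfold modelC
  refine ContinuousOn.add ?_ ?_
  · exact ContinuousOn.div continuousOn_const (by fun_prop) fun u hu => by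
      have hu : (1 : ℝ) < u := hu
      positivity
  · exact ContinuousOn.div continuousOn_const (by fun_prop) h

/-- **THE WALL SOLUTION EXISTS GLOBALLY**: an outer solution of MODEL M on `(1, ∞)` with `R(6) = 0`, `R′(6) = −1`
(linear equation with coefficients continuous on `(1, ∞)`). [cite: Hartman2002, Ch. IV Lemma 1.1] -/
theorem wallSolution_exists : ∃ R R' : ℝ → ℝ, R 6 = 0 ∧ R' 6 = -1 ∧ IsScaledOuterSolution R R' (Ioi 1) := by
  have hp : ContinuousOn (fun u : ℝ => -1 / u) (Ioi 1) :=
    ContinuousOn.div continuousOn_const continuousOn_id fun u hu => by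
      have hu : (1 : ℝ) < u := hu
      exact ne_of_gt (by linarith)
  obtain ⟨R, R', h0, h1, h⟩ := exists_solution_Ioi (𝕜 := ℝ) hp continuousOn_modelC 6 (0 : ℝ) (-1 : ℝ)
  refine ⟨R, R', h0, h1, fun u hu => ⟨(h u hu).1, ((h u hu).2).congr_deriv ?_⟩⟩
  rw [modelC]; ring

/-- UNIQUENESS on an open subinterval of `(1, ∞)`: two outer solutions with the same data at one point agree.
[cite: Hartman2002, Ch. IV Lemma 1.1] -/
theorem outer_eqOn {L L' R R' : ℝ → ℝ} {a b t₀ : ℝ} (ha : 1 ≤ a) (ht₀ : t₀ ∈ Ioo a b)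
    (hL : IsScaledOuterSolution L L' (Ioo a b)) (hR : IsScaledOuterSolution R R' (Ioo a b))
    (h0 : L t₀ = R t₀) (h1 : L' t₀ = R' t₀) : EqOn L R (Ioo a b) ∧ EqOn L' R' (Ioo a b) := by
  have hsub : Ioo a b ⊆ Ioi 1 := fun u hu => lt_of_le_of_lt ha hu.1
  have hp : ContinuousOn (fun u : ℝ => -1 / u) (Ioo a b) :=
    ContinuousOn.div continuousOn_const continuousOn_id fun u hu => by
      have := hsub hu; exact ne_of_gt (by simpa using lt_trans zero_lt_one this)
  have hq : ContinuousOn modelC (Ioo a b) := continuousOn_modelC.mono hsub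
  refine eqOn_of_solution_Ioo (𝕜 := ℝ) hp hq ht₀ (fun u hu => ⟨(hL u hu).1, ((hL u hu).2).congr_deriv ?_⟩)
    (fun u hu => ⟨(hR u hu).1, ((hR u hu).2).congr_deriv ?_⟩) h0 h1
  · rw [modelC]; ring
  · rw [modelC]; ring

/-! ### Rational bounds for the exponential factors -/

/-- `exp x ≤ ((1 − x/n)⁻¹)ⁿ` for `0 ≤ x` and `x < n` (from `1 + y ≤ exp y` at `y = −x/n`). [folklore] -/
theorem exp_le_inv_pow {x : ℝ} {n : ℕ} (hn : 0 < n) (hx : x < n) :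
    Real.exp x ≤ ((1 - x / n)⁻¹) ^ n := by
  have hn' : (0 : ℝ) < n := by exact_mod_cast hn
  have hpos : 0 < 1 - x / n := by
    rw [sub_pos, div_lt_one hn']; exact hx
  have h1 : 1 - x / n ≤ Real.exp (-(x / n)) := by
    have := Real.add_one_le_exp (-(x / n)); linarith
  have h2 : (1 - x / n) ^ n ≤ Real.exp (-x) := by
    calc (1 - x / n) ^ n ≤ (Real.exp (-(x / n))) ^ n := pow_le_pow_left₀ hpos.le h1 n
      _ = Real.exp (-x) := by rw [← Real.exp_nat_mul]; congr 1; field_simp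
  rw [inv_pow, le_inv_comm₀ (Real.exp_pos x) (pow_pos hpos n), ← Real.exp_neg]
  exact h2

end TearingFRS1

end Summit.Ventures.FusionMHD.Models

end
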